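import Summits.QuantumFields.YangMills.Theorems.F4SubCurvatureDoorShortRootRigidityConePackaging
import Summits.QuantumFields.YangMills.Theorems.F4SubCurvatureDoorShortRootRigidityPlanarConeSupportHolds
import HarnessLib

/-!
# (C) «PLANAR SPECTRAL CONE» BY NAME — crux ⟨stmt-QuantumFields-23035⟩ `F4SubCurvatureDoor.ShortRootRigidity`

The registered stub (C) `stub_planarSpectralCone : ∀ k : E2 → ℝ, InPlanarClass k → PlanarSpectralCone k` of LINE g20-A
(`Cruxes/ShortRootRigidity/Lines/angular_type.lean` :128; the XL «new lever» of that line, refined by LINE g21-C «aperture bootstrap») is now an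
UNCONDITIONAL tree theorem: the cone packaging `stub_planarSpectralCone_of_coneSupport` (✓p723376, w3 g38; LINE g21-C :141) applied to the
support form `planarConeSupport_holds` (✓p724805, sfw-p2 g75; = `planarConeSupport_of_apertureStep` ✓p723103 ∘ THE STEP
`stub_planarApertureStep` ✓p724234 ∘ `flatDoubleEdge_holds` ✓p723152).  In words: for every kernel `k` of the planar class and every
`ε > 0`, the shifted axis restriction `(t, b) ↦ k(ε + t, b)` is the real trace of a function holomorphic on the forward tube `{|Im β| < Re ζ}`
and bounded there by the cone majorant `k(ε + Re ζ − |Im β|, 0)` — the Laplace–Fourier measure of every frame is carried by the forward light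
cone `{E ≥ |p|}`.

`PlanarSpectralCone` is, as in both skeletons, the `abbrev` of the landed chart text `AngularType.PlanarSpectralConeFrame`
(`…ConePackagingRegistered.PlanarSpectralCone`, ✓p723376); `InPlanarClass` = `…SliceInClassRegistered.InPlanarClass`; the two restated copies of
`PlanarConeSupport` / `IsPlanarLF` / `HasAperture` (✓p723376 vs ✓p723103/✓p722363) agree by `rfl` after eta-expansion.

HONEST LABEL: (C) closes; the crux ⟨23035⟩ `ShortRootRigidity` still needs the shared stub (4) `stub_oddModeRigidity` (open); ⟨23125⟩, R2d
and the Yang–Mills mass gap remain OPEN; no summit is proved by a line.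
-/

noncomputable section

namespace Summit.QuantumFields.YangMills.Theorems.F4SubCurvatureDoorPlanarSpectralConeByName

open Summit.QuantumFields.YangMills.Theorems.F4SubCurvatureDoorSliceDensityRegistered (E2)
open Summit.QuantumFields.YangMills.Theorems.F4SubCurvatureDoorSliceInClassRegistered (InPlanarClass)
open Summit.QuantumFields.YangMills.Theorems.F4SubCurvatureDoorConePackagingRegistered
  (PlanarSpectralCone stub_planarSpectralCone_of_coneSupport)
open Summit.QuantumFields.YangMills.Theorems.F4SubCurvatureDoorPlanarConeSupportByName (planarConeSupport_holds)

/-- **Registered stub (C) «PLANAR SPECTRAL CONE» of LINE g20-A, BY NAME AND SIGNATURE — now unconditional.** [folklore assembly] -/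
theorem stub_planarSpectralCone : ∀ k : E2 → ℝ, InPlanarClass k → PlanarSpectralCone k :=
  stub_planarSpectralCone_of_coneSupport fun k μ hk hμ => planarConeSupport_holds k μ hk hμ

/-- Alias: `planarSpectralCone_holds`. -/
theorem planarSpectralCone_holds : ∀ k : E2 → ℝ, InPlanarClass k → PlanarSpectralCone k := stub_planarSpectralCone

end Summit.QuantumFields.YangMills.Theorems.F4SubCurvatureDoorPlanarSpectralConeByName

end
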